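import Summits.QuantumFields.YangMills.Theorems.LuscherReductionTwistedTraceScalingBOCentralRatesSeven
import HarnessLib

/-!
# (B-O) central tube — RATES, part 8: the four tails of the bound of record are `o(β^{-1/5})` (weighted limits)

Companion of `…BOCentralRatesSeven`.  The additive tails of `lo₀/N`, `hi₀/N` — the slice Laplace tail (with and without the Gaussian loss),
the relative Gaussian tail of the lower bound, the gauge-far term — are all `≤ C·e^{-ℓ}` eventually (`ℓ = btLog β = log β`), hence their
products with the weight `W = β^{1/5} = e^{ℓ/5}` still tend to `0`.  §1 the generic lemma (`0 ≤ t ≤ C·e^{-ℓ}` eventually ⇒ `t·W → 0`, `t → 0`);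
§2 the explicit `C·e^{-ℓ}` dominations (the inequalities inside the proofs of `…BOCentralRatesTwo.tendsto_sliceTail_mul_gaussLoss`,
`…tendsto_gaussTail`, `…BOCentralRatesFour.tendsto_farTail`, exported); §3 the four weighted tails.
HONEST FRAMING: rate bookkeeping for (C1); (C4), (C5), (B-ST), C4-CORE OPEN; stub of a child of the CONDITIONAL route R2b1; not a gap, not Clay.
-/

open MeasureTheory Filter Topology Real
open scoped BigOperators
open Literature.MathematicalPhysics.QuantumFieldTheory
open Literature.MathematicalPhysics.QuantumLattice

namespace Summit.QuantumFields.YangMills.Theorems.FemtoTransferGap.TwoLattice.ConstTube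

open Summit.QuantumFields.YangMills.Theorems.FemtoTransferGap
open Summit.QuantumFields.YangMills.Theorems.FemtoTransferGap.TwoLattice
open Summit.QuantumFields.YangMills.Theorems.FemtoTransferGap.TwoLattice.Stiff

variable {L : ℕ}

/-! ## §1 Exponentially small tails absorb the polynomial weight -/

/-- `W = e^{ℓ/5}` eventually (`β ≥ e`). [folklore] -/
theorem eventually_weight_eq_exp : ∀ᶠ β : ℝ in atTop, powScale (-(1 / 5)) β = Real.exp (btLog β / 5) := by
  filter_upwards [eventually_btLog_eq, eventually_ge_atTop (1 : ℝ)] with β hℓ hβ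
  have hβ0 : 0 < β := by linarith
  rw [powScale_eq hβ, neg_neg, Real.rpow_def_of_pos hβ0, hℓ]
  ring_nf

/-- ★ **Generic weighted tail**: `0 ≤ t ≤ C·e^{-ℓ}` eventually ⇒ `t·W → 0` and `t → 0` (`e^{-ℓ}·W = e^{-4ℓ/5}`). [folklore] -/
theorem zt_of_le_exp_neg {t : ℝ → ℝ} (C : ℝ) (h : ∀ᶠ β : ℝ in atTop, 0 ≤ t β ∧ t β ≤ C * Real.exp (-btLog β)) :
    Tendsto (fun β => t β * powScale (-(1 / 5)) β) atTop (𝓝 0) ∧ Tendsto t atTop (𝓝 0) := by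
  have hC : ∀ᶠ β : ℝ in atTop, 0 ≤ C := by
    filter_upwards [h] with β hβ
    by_contra hC
    push Not at hC
    have : C * Real.exp (-btLog β) < 0 := mul_neg_of_neg_of_pos hC (Real.exp_pos _)
    linarith [hβ.1, hβ.2]
  have he1 : Tendsto (fun β : ℝ => C * Real.exp (-btLog β)) atTop (𝓝 0) := by
    simpa using (Real.tendsto_exp_atBot.comp (tendsto_neg_atTop_atBot.comp tendsto_btLog_atTop)).const_mul C
  have he2 : Tendsto (fun β : ℝ => C * Real.exp (-(4 / 5 * btLog β))) atTop (𝓝 0) := by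
    have h45 : Tendsto (fun β : ℝ => 4 / 5 * btLog β) atTop atTop := tendsto_btLog_atTop.const_mul_atTop (by norm_num)
    simpa using (Real.tendsto_exp_atBot.comp (tendsto_neg_atTop_atBot.comp h45)).const_mul C
  constructor
  · refine tendsto_of_tendsto_of_tendsto_of_le_of_le' tendsto_const_nhds he2 ?_ ?_
    · filter_upwards [h] with β hβ; exact mul_nonneg hβ.1 (weight_pos β).le
    · filter_upwards [h, eventually_weight_eq_exp, hC] with β hβ hW hC0
      rw [hW]
      calc t β * Real.exp (btLog β / 5) ≤ C * Real.exp (-btLog β) * Real.exp (btLog β / 5) :=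
            mul_le_mul_of_nonneg_right hβ.2 (Real.exp_pos _).le
        _ = C * Real.exp (-(4 / 5 * btLog β)) := by rw [mul_assoc, ← Real.exp_add]; ring_nf
  · refine tendsto_of_tendsto_of_tendsto_of_le_of_le' tendsto_const_nhds he1 ?_ ?_
    · filter_upwards [h] with β hβ; exact hβ.1
    · filter_upwards [h] with β hβ; exact hβ.2

/-! ## §2 The `C·e^{-ℓ}` dominations -/

section Dominations

variable [NeZero L]

/-- **Slice Laplace tail × Gaussian loss `≤ 2·4^{d/2}·e^{-ℓ}` eventually** (the domination inside `tendsto_sliceTail_mul_gaussLoss`). [folklore] -/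
theorem sliceTail_mul_gaussLoss_le (KD Ksp : ℝ) :
    ∀ᶠ β : ℝ in atTop, 0 ≤ (1 + KD * ((4 + 48 * Ksp) * (8 * (9 * (L : ℝ) * (5 * (powScale (1 / 2) β * btLog β ^ 2)) + powScale 1 β))) ^ 2) *
        (4 : ℝ) ^ (flatDim L / 2 : ℝ) * Real.exp (-((1 / (4 * sliceConst L)) ^ 2 * (powScale 1 β * btLog β ^ 3) ^ 2 / (4 * (powScale 1 β) ^ 2))) *
      Real.exp ((96 * (β / 2) + β) * (Real.sqrt ((Fintype.card (Edge 3 L) : ℝ)) * (8 * (9 * (L : ℝ) * (5 * (powScale (1 / 2) β * btLog β ^ 2)) + powScale 1 β))) ^ 2) ∧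
      (1 + KD * ((4 + 48 * Ksp) * (8 * (9 * (L : ℝ) * (5 * (powScale (1 / 2) β * btLog β ^ 2)) + powScale 1 β))) ^ 2) *
        (4 : ℝ) ^ (flatDim L / 2 : ℝ) * Real.exp (-((1 / (4 * sliceConst L)) ^ 2 * (powScale 1 β * btLog β ^ 3) ^ 2 / (4 * (powScale 1 β) ^ 2))) *
      Real.exp ((96 * (β / 2) + β) * (Real.sqrt ((Fintype.card (Edge 3 L) : ℝ)) * (8 * (9 * (L : ℝ) * (5 * (powScale (1 / 2) β * btLog β ^ 2)) + powScale 1 β))) ^ 2) ≤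
        (2 * (4 : ℝ) ^ (flatDim L / 2 : ℝ)) * Real.exp (-btLog β) := by
  set c : ℝ := 1 / (4 * sliceConst L) with hcdef
  set M : ℝ := 49 * (Fintype.card (Edge 3 L) : ℝ) * (64 * (45 * (L : ℝ) + 1) ^ 2) with hMdef
  have hc : 0 < c := by rw [hcdef]; have := sliceConst_pos L; positivity
  have hρ' : Tendsto (fun β : ℝ => KD * ((4 + 48 * Ksp) * (8 * (9 * (L : ℝ) * (5 * (powScale (1 / 2) β * btLog β ^ 2)) + powScale 1 β))) ^ 2) atTop (𝓝 0) := by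
    simpa using (((tendsto_schedRho (L := L)).const_mul (4 + 48 * Ksp)).pow 2).const_mul KD
  have hℓ2 : ∀ᶠ β : ℝ in atTop, 4 * (M + 1) / c ^ 2 ≤ btLog β ^ 2 :=
    ((tendsto_pow_atTop two_ne_zero).comp tendsto_btLog_atTop).eventually_ge_atTop _
  have hlow : ∀ᶠ β : ℝ in atTop, -(1 / 2 : ℝ) ≤ KD * ((4 + 48 * Ksp) * (8 * (9 * (L : ℝ) * (5 * (powScale (1 / 2) β * btLog β ^ 2)) + powScale 1 β))) ^ 2 :=
    hρ'.eventually (Ici_mem_nhds (by norm_num))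
  have hhigh : ∀ᶠ β : ℝ in atTop, KD * ((4 + 48 * Ksp) * (8 * (9 * (L : ℝ) * (5 * (powScale (1 / 2) β * btLog β ^ 2)) + powScale 1 β))) ^ 2 ≤ 1 :=
    hρ'.eventually (Iic_mem_nhds (by norm_num))
  filter_upwards [hlow, hhigh, hℓ2, eventually_ge_atTop (1 : ℝ)] with β hlo hhi hl2 hβ
  have hℓ := one_le_btLog β
  have hP0 : 0 ≤ 1 + KD * ((4 + 48 * Ksp) * (8 * (9 * (L : ℝ) * (5 * (powScale (1 / 2) β * btLog β ^ 2)) + powScale 1 β))) ^ 2 := by linarith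
  have hP : 1 + KD * ((4 + 48 * Ksp) * (8 * (9 * (L : ℝ) * (5 * (powScale (1 / 2) β * btLog β ^ 2)) + powScale 1 β))) ^ 2 ≤ 2 := by linarith
  refine ⟨by positivity, ?_⟩
  -- the exponent
  have hexp : -(c ^ 2 * (powScale 1 β * btLog β ^ 3) ^ 2 / (4 * powScale 1 β ^ 2)) +
      (96 * (β / 2) + β) * (Real.sqrt ((Fintype.card (Edge 3 L) : ℝ)) * (8 * (9 * (L : ℝ) * (5 * (powScale (1 / 2) β * btLog β ^ 2)) + powScale 1 β))) ^ 2 ≤ -btLog β := by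
    have h1 : c ^ 2 * (powScale 1 β * btLog β ^ 3) ^ 2 / (4 * powScale 1 β ^ 2) = c ^ 2 * (btLog β ^ 6 / 4) := by
      rw [mul_div_assoc, core_sq_div_eps_sq]
    have h2 := gaussLoss_exponent_le (L := L) hβ
    rw [← hMdef] at h2
    rw [h1]
    have h3 : 4 * (M + 1) ≤ c ^ 2 * btLog β ^ 2 := by
      have := (div_le_iff₀ (by positivity : (0 : ℝ) < c ^ 2)).1 hl2
      linarith
    have hℓ4 : btLog β ≤ btLog β ^ 4 := by
      calc btLog β = btLog β ^ 1 := (pow_one _).symm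
        _ ≤ btLog β ^ 4 := pow_le_pow_right₀ hℓ (by norm_num)
    have hM0 : 0 ≤ M := by rw [hMdef]; positivity
    have hl40 : 0 ≤ btLog β ^ 4 := by positivity
    have key : btLog β ^ 4 ≤ c ^ 2 * (btLog β ^ 6 / 4) - M * btLog β ^ 4 := by
      have e : c ^ 2 * (btLog β ^ 6 / 4) - M * btLog β ^ 4 = btLog β ^ 4 * ((c ^ 2 * btLog β ^ 2) / 4 - M) := by ring
      rw [e]
      have : 1 ≤ (c ^ 2 * btLog β ^ 2) / 4 - M := by linarith
      nlinarith
    linarith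
  calc (1 + KD * ((4 + 48 * Ksp) * (8 * (9 * (L : ℝ) * (5 * (powScale (1 / 2) β * btLog β ^ 2)) + powScale 1 β))) ^ 2) *
        (4 : ℝ) ^ (flatDim L / 2 : ℝ) * Real.exp (-(c ^ 2 * (powScale 1 β * btLog β ^ 3) ^ 2 / (4 * powScale 1 β ^ 2))) *
        Real.exp ((96 * (β / 2) + β) * (Real.sqrt ((Fintype.card (Edge 3 L) : ℝ)) * (8 * (9 * (L : ℝ) * (5 * (powScale (1 / 2) β * btLog β ^ 2)) + powScale 1 β))) ^ 2)
      = (1 + KD * ((4 + 48 * Ksp) * (8 * (9 * (L : ℝ) * (5 * (powScale (1 / 2) β * btLog β ^ 2)) + powScale 1 β))) ^ 2) *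
        (4 : ℝ) ^ (flatDim L / 2 : ℝ) * Real.exp (-(c ^ 2 * (powScale 1 β * btLog β ^ 3) ^ 2 / (4 * powScale 1 β ^ 2)) +
          (96 * (β / 2) + β) * (Real.sqrt ((Fintype.card (Edge 3 L) : ℝ)) * (8 * (9 * (L : ℝ) * (5 * (powScale (1 / 2) β * btLog β ^ 2)) + powScale 1 β))) ^ 2) := by
        rw [Real.exp_add]; ring
    _ ≤ 2 * (4 : ℝ) ^ (flatDim L / 2 : ℝ) * Real.exp (-btLog β) := by gcongr
    _ = (2 * (4 : ℝ) ^ (flatDim L / 2 : ℝ)) * Real.exp (-btLog β) := by ring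

/-- **Slice Laplace tail alone `≤ 2·4^{d/2}·e^{-ℓ}` eventually** (the Gaussian-loss factor is `≥ 1`). [folklore] -/
theorem sliceTail_le (KD Ksp : ℝ) :
    ∀ᶠ β : ℝ in atTop, 0 ≤ (1 + KD * ((4 + 48 * Ksp) * (8 * (9 * (L : ℝ) * (5 * (powScale (1 / 2) β * btLog β ^ 2)) + powScale 1 β))) ^ 2) *
        (4 : ℝ) ^ (flatDim L / 2 : ℝ) * Real.exp (-((1 / (4 * sliceConst L)) ^ 2 * (powScale 1 β * btLog β ^ 3) ^ 2 / (4 * (powScale 1 β) ^ 2))) ∧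
      (1 + KD * ((4 + 48 * Ksp) * (8 * (9 * (L : ℝ) * (5 * (powScale (1 / 2) β * btLog β ^ 2)) + powScale 1 β))) ^ 2) *
        (4 : ℝ) ^ (flatDim L / 2 : ℝ) * Real.exp (-((1 / (4 * sliceConst L)) ^ 2 * (powScale 1 β * btLog β ^ 3) ^ 2 / (4 * (powScale 1 β) ^ 2))) ≤
        (2 * (4 : ℝ) ^ (flatDim L / 2 : ℝ)) * Real.exp (-btLog β) := by
  have hρ' : Tendsto (fun β : ℝ => KD * ((4 + 48 * Ksp) * (8 * (9 * (L : ℝ) * (5 * (powScale (1 / 2) β * btLog β ^ 2)) + powScale 1 β))) ^ 2) atTop (𝓝 0) := by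
    simpa using (((tendsto_schedRho (L := L)).const_mul (4 + 48 * Ksp)).pow 2).const_mul KD
  have hlow : ∀ᶠ β : ℝ in atTop, -(1 / 2 : ℝ) ≤ KD * ((4 + 48 * Ksp) * (8 * (9 * (L : ℝ) * (5 * (powScale (1 / 2) β * btLog β ^ 2)) + powScale 1 β))) ^ 2 :=
    hρ'.eventually (Ici_mem_nhds (by norm_num))
  filter_upwards [hlow, sliceTail_mul_gaussLoss_le (L := L) KD Ksp, eventually_ge_atTop (1 : ℝ)] with β hlo hTG hβ
  have hP0 : 0 ≤ 1 + KD * ((4 + 48 * Ksp) * (8 * (9 * (L : ℝ) * (5 * (powScale (1 / 2) β * btLog β ^ 2)) + powScale 1 β))) ^ 2 := by linarith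
  have h0 : 0 ≤ (1 + KD * ((4 + 48 * Ksp) * (8 * (9 * (L : ℝ) * (5 * (powScale (1 / 2) β * btLog β ^ 2)) + powScale 1 β))) ^ 2) *
      (4 : ℝ) ^ (flatDim L / 2 : ℝ) * Real.exp (-((1 / (4 * sliceConst L)) ^ 2 * (powScale 1 β * btLog β ^ 3) ^ 2 / (4 * (powScale 1 β) ^ 2))) := by
    positivity
  refine ⟨h0, ?_⟩
  have h1 : 1 ≤ Real.exp ((96 * (β / 2) + β) * (Real.sqrt ((Fintype.card (Edge 3 L) : ℝ)) * (8 * (9 * (L : ℝ) * (5 * (powScale (1 / 2) β * btLog β ^ 2)) + powScale 1 β))) ^ 2) := by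
    apply Real.one_le_exp
    have : 0 ≤ β := by linarith
    positivity
  exact (le_mul_of_one_le_right h0 h1).trans hTG.2

/-- **Relative Gaussian tail `≤ 14^{d}·e^{-ℓ}` eventually** (the domination `14^{d}e^{-ℓ²/18}` inside `tendsto_gaussTail`, and `ℓ ≥ 18`). [folklore] -/
theorem gaussTail_le :
    ∀ᶠ β : ℝ in atTop, 0 ≤ Real.exp (49 * β * (min (1 / 40) (powScale (1 / 2) β * btLog β) / 12) ^ 2) *
      (Real.exp (-(β * (min (8 * (9 * (L : ℝ) * (5 * (powScale (1 / 2) β * btLog β ^ 2)) + powScale 1 β) -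
          2 * (9 * (L : ℝ) * (5 * (powScale (1 / 2) β * btLog β ^ 2)) + powScale 1 β))
          (9 / 10 * min (1 / 40) (powScale (1 / 2) β * btLog β) -
            6 * (9 * (L : ℝ) * (5 * (powScale (1 / 2) β * btLog β ^ 2)) + powScale 1 β) ^ 2 * (min (1 / 40) (powScale (1 / 2) β * btLog β) / 12))) ^ 2 / 2)) *
        (π / (β / 2)) ^ ((Module.finrank ℝ (LinkSpace L) : ℝ) / 2)) / stiffGaussTop L (β / 2) β ∧
      Real.exp (49 * β * (min (1 / 40) (powScale (1 / 2) β * btLog β) / 12) ^ 2) *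
      (Real.exp (-(β * (min (8 * (9 * (L : ℝ) * (5 * (powScale (1 / 2) β * btLog β ^ 2)) + powScale 1 β) -
          2 * (9 * (L : ℝ) * (5 * (powScale (1 / 2) β * btLog β ^ 2)) + powScale 1 β))
          (9 / 10 * min (1 / 40) (powScale (1 / 2) β * btLog β) -
            6 * (9 * (L : ℝ) * (5 * (powScale (1 / 2) β * btLog β ^ 2)) + powScale 1 β) ^ 2 * (min (1 / 40) (powScale (1 / 2) β * btLog β) / 12))) ^ 2 / 2)) *
        (π / (β / 2)) ^ ((Module.finrank ℝ (LinkSpace L) : ℝ) / 2)) / stiffGaussTop L (β / 2) β ≤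
        (14 : ℝ) ^ Fintype.card (Edge 3 L × Fin 3) * Real.exp (-btLog β) := by
  have hrf : ∀ᶠ β : ℝ in atTop, powScale (1 / 2) β * btLog β < 1 / 40 := tendsto_rf.eventually (Iio_mem_nhds (by norm_num))
  have hT : ∀ᶠ β : ℝ in atTop, 9 * (L : ℝ) * (5 * (powScale (1 / 2) β * btLog β ^ 2)) + powScale 1 β < 1 / 8 :=
    (tendsto_schedT (L := L)).eventually (Iio_mem_nhds (by norm_num))
  have h18 : ∀ᶠ β : ℝ in atTop, (18 : ℝ) ≤ btLog β := tendsto_btLog_atTop.eventually_ge_atTop _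
  filter_upwards [eventually_ge_atTop (1 : ℝ), hrf, hT, h18] with β hβ hrf' hT' hℓ18
  have hβ0 : 0 < β := by linarith
  have hx := (powScale_pos (1 / 2) β).le
  have hℓ := one_le_btLog β
  obtain ⟨hSlo, -⟩ := stiffGaussTop_record_bounds (L := L) hβ0
  have hS : 0 < stiffGaussTop L (β / 2) β := lt_of_lt_of_le (pow_pos (Real.sqrt_pos.2 (by positivity)) _) hSlo
  refine ⟨by positivity, ?_⟩
  have hmin : min (1 / 40) (powScale (1 / 2) β * btLog β) = powScale (1 / 2) β * btLog β := min_eq_right hrf'.le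
  have h2 : β * powScale (1 / 2) β ^ 2 = 1 := mul_powScale_half_sq hβ
  rw [hmin]
  set rf := powScale (1 / 2) β * btLog β with hrfdef
  set T := 9 * (L : ℝ) * (5 * (powScale (1 / 2) β * btLog β ^ 2)) + powScale 1 β with hTdef
  have hrf0 : 0 ≤ rf := by positivity
  have hT0 : 0 ≤ T := by rw [hTdef]; have := powScale_pos 1 β; positivity
  have hrfT : rf ≤ T := by
    have := rf_le_schedT (L := L) β
    rw [hmin] at this
    exact this
  have hT2 : T ^ 2 ≤ 1 / 50 := by nlinarith
  have hβrf : β * rf ^ 2 = btLog β ^ 2 := by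
    rw [hrfdef]
    calc β * (powScale (1 / 2) β * btLog β) ^ 2 = (β * powScale (1 / 2) β ^ 2) * btLog β ^ 2 := by ring
      _ = btLog β ^ 2 := by rw [h2, one_mul]
  have hm : 89 / 100 * rf ≤ min (8 * T - 2 * T) (9 / 10 * rf - 6 * T ^ 2 * (rf / 12)) := by
    refine le_min ?_ ?_
    · nlinarith
    · nlinarith
  have hm2 : (89 / 100 * rf) ^ 2 ≤ (min (8 * T - 2 * T) (9 / 10 * rf - 6 * T ^ 2 * (rf / 12))) ^ 2 := pow_le_pow_left₀ (by positivity) hm 2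
  have hexp : 49 * β * (rf / 12) ^ 2 + -(β * (min (8 * T - 2 * T) (9 / 10 * rf - 6 * T ^ 2 * (rf / 12))) ^ 2 / 2) ≤ -btLog β := by
    have h1 : β * (89 / 100 * rf) ^ 2 ≤ β * (min (8 * T - 2 * T) (9 / 10 * rf - 6 * T ^ 2 * (rf / 12))) ^ 2 :=
      mul_le_mul_of_nonneg_left hm2 hβ0.le
    have e : 49 * β * (rf / 12) ^ 2 - β * (89 / 100 * rf) ^ 2 / 2 = (49 / 144 - 7921 / 20000) * (β * rf ^ 2) := by ring
    have h3 : (49 / 144 - 7921 / 20000) * (β * rf ^ 2) ≤ -btLog β := by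
      rw [hβrf]
      -- `(7921/20000 − 49/144)·ℓ² ≥ ℓ²/18 ≥ ℓ` for `ℓ ≥ 18`
      nlinarith
    linarith
  have hG := gauss_norm_div_stiffGaussTop_le (L := L) hβ0
  have hG0 : 0 ≤ (π / (β / 2)) ^ ((Module.finrank ℝ (LinkSpace L) : ℝ) / 2) / stiffGaussTop L (β / 2) β := by positivity
  calc Real.exp (49 * β * (rf / 12) ^ 2) *
        (Real.exp (-(β * (min (8 * T - 2 * T) (9 / 10 * rf - 6 * T ^ 2 * (rf / 12))) ^ 2 / 2)) *
          (π / (β / 2)) ^ ((Module.finrank ℝ (LinkSpace L) : ℝ) / 2)) / stiffGaussTop L (β / 2) β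
      = Real.exp (49 * β * (rf / 12) ^ 2 + -(β * (min (8 * T - 2 * T) (9 / 10 * rf - 6 * T ^ 2 * (rf / 12))) ^ 2 / 2)) *
          ((π / (β / 2)) ^ ((Module.finrank ℝ (LinkSpace L) : ℝ) / 2) / stiffGaussTop L (β / 2) β) := by
        rw [Real.exp_add]; ring
    _ ≤ Real.exp (-btLog β) * (14 : ℝ) ^ Fintype.card (Edge 3 L × Fin 3) := by gcongr
    _ = (14 : ℝ) ^ Fintype.card (Edge 3 L × Fin 3) * Real.exp (-btLog β) := mul_comm _ _

/-- **Gauge-far term `≤ C·e^{-ℓ}` eventually** (the domination inside `tendsto_farTail`). [folklore] -/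
theorem farTail_le :
    ∀ᶠ β : ℝ in atTop, 0 ≤ Real.exp (-(β * (8 * (9 * (L : ℝ) * (5 * (powScale (1 / 2) β * btLog β ^ 2)) + powScale 1 β)) ^ 2 / 4)) *
        Real.exp (49 * β * (min (1 / 40) (powScale (1 / 2) β * btLog β) / 12) ^ 2) / stiffGaussTop L (β / 2) β /
      (((2 * π ^ 2)⁻¹) ^ Fintype.card (Edge 3 L) * fpZ (powScale 1 β) * fpWeightBar L (powScale 1 β)) ∧
      Real.exp (-(β * (8 * (9 * (L : ℝ) * (5 * (powScale (1 / 2) β * btLog β ^ 2)) + powScale 1 β)) ^ 2 / 4)) *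
        Real.exp (49 * β * (min (1 / 40) (powScale (1 / 2) β * btLog β) / 12) ^ 2) / stiffGaussTop L (β / 2) β /
      (((2 * π ^ 2)⁻¹) ^ Fintype.card (Edge 3 L) * fpZ (powScale 1 β) * fpWeightBar L (powScale 1 β)) ≤
      ((98 : ℝ) ^ Fintype.card (Edge 3 L × Fin 3) * ((2 * π ^ 2) ^ Fintype.card (Edge 3 L) * 80 * ((2 * π ^ 2) ^ Fintype.card (NzSite L) * Real.sqrt (gramDet L 0)))) *
        Real.exp (-btLog β) := by
  set n := Fintype.card (Edge 3 L × Fin 3) with hndef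
  set d := flatDim L with hddef
  set C : ℝ := (98 : ℝ) ^ n * ((2 * π ^ 2) ^ Fintype.card (Edge 3 L) * 80 * ((2 * π ^ 2) ^ Fintype.card (NzSite L) * Real.sqrt (gramDet L 0))) with hCdef
  have hG : 0 < Real.sqrt (gramDet L 0) := Real.sqrt_pos.mpr (gramDet_zero_pos L)
  have hC : 0 ≤ C := by rw [hCdef]; positivity
  have hrf : ∀ᶠ β : ℝ in atTop, powScale (1 / 2) β * btLog β < 1 / 40 := tendsto_rf.eventually (Iio_mem_nhds (by norm_num))
  have hℓ2 : ∀ᶠ β : ℝ in atTop, ((n : ℝ) + d + 5) ≤ btLog β ^ 2 :=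
    ((tendsto_pow_atTop two_ne_zero).comp tendsto_btLog_atTop).eventually_ge_atTop _
  filter_upwards [eventually_ge_atTop (1 : ℝ), eventually_btLog_eq, hrf, hℓ2] with β hβ hℓeq hrf' hl2
  have hβ0 : 0 < β := by linarith
  have hℓ := one_le_btLog β
  set ℓ := btLog β with hℓdef
  set ε := powScale 1 β with hεdef
  set x := powScale (1 / 2) β with hxdef
  have hε : 0 < ε := powScale_pos 1 β
  have hε1 : ε ≤ 1 := powScale_le_one (by norm_num) β
  have hx0 : 0 ≤ x := (powScale_pos _ _).le
  have hβε : β * ε = 1 := mul_powScale_one hβ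
  have hβx : β * x ^ 2 = 1 := mul_powScale_half_sq hβ
  have hexpℓ : Real.exp ℓ = β := by rw [hℓeq, Real.exp_log hβ0]
  obtain ⟨hSlo, -⟩ := stiffGaussTop_record_bounds (L := L) hβ0
  have hS : 0 < stiffGaussTop L (β / 2) β := lt_of_lt_of_le (pow_pos (Real.sqrt_pos.2 (by positivity)) _) hSlo
  have hZ := fpZ_pos hε
  have hW := fpWeightBar_pos (L := L) hε
  refine ⟨by positivity, ?_⟩
  -- (1) the Gaussian factor `e^{-βρ²/4} ≤ e^{-ℓ⁴}`
  have h1 : Real.exp (-(β * (8 * (9 * (L : ℝ) * (5 * (x * ℓ ^ 2)) + ε)) ^ 2 / 4)) ≤ Real.exp (-ℓ ^ 4) := by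
    apply Real.exp_le_exp.2
    have hL1 : (1 : ℝ) ≤ L := by exact_mod_cast NeZero.one_le
    have hρ : 2 * (x * ℓ ^ 2) ≤ 8 * (9 * (L : ℝ) * (5 * (x * ℓ ^ 2)) + ε) := by
      have : 0 ≤ x * ℓ ^ 2 := by positivity
      nlinarith
    have hρ2 : (2 * (x * ℓ ^ 2)) ^ 2 ≤ (8 * (9 * (L : ℝ) * (5 * (x * ℓ ^ 2)) + ε)) ^ 2 := pow_le_pow_left₀ (by positivity) hρ 2
    have : ℓ ^ 4 ≤ β * (8 * (9 * (L : ℝ) * (5 * (x * ℓ ^ 2)) + ε)) ^ 2 / 4 := by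
      calc ℓ ^ 4 = β * (2 * (x * ℓ ^ 2)) ^ 2 / 4 := by
            have : β * (2 * (x * ℓ ^ 2)) ^ 2 / 4 = (β * x ^ 2) * ℓ ^ 4 := by ring
            rw [this, hβx, one_mul]
        _ ≤ β * (8 * (9 * (L : ℝ) * (5 * (x * ℓ ^ 2)) + ε)) ^ 2 / 4 := by gcongr
    linarith
  -- (2) the localisation gain `e^{49βR_in²} ≤ e^{ℓ²}`
  have h2 : Real.exp (49 * β * (min (1 / 40) (x * ℓ) / 12) ^ 2) ≤ Real.exp (ℓ ^ 2) := by
    apply Real.exp_le_exp.2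
    rw [min_eq_right hrf'.le]
    have : 49 * β * (x * ℓ / 12) ^ 2 = 49 / 144 * ((β * x ^ 2) * ℓ ^ 2) := by ring
    rw [this, hβx, one_mul]
    nlinarith [sq_nonneg ℓ]
  -- (3) the three polynomial floors
  have h3 := inv_stiffGaussTop_le (L := L) hβ
  have hεinv : ε⁻¹ = β := (eq_inv_of_mul_eq_one_left hβε).symm
  have h4 : (fpZ ε)⁻¹ ≤ 80 * β ^ 3 := by
    have := fpZ_ge hε hε1
    calc (fpZ ε)⁻¹ ≤ (ε ^ 3 / 80)⁻¹ := inv_anti₀ (by positivity) this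
      _ = 80 * β ^ 3 := by rw [inv_div, div_eq_mul_inv, ← inv_pow, hεinv]
  have h5 : (fpWeightBar L ε)⁻¹ ≤ (2 * π ^ 2) ^ Fintype.card (NzSite L) * Real.sqrt (gramDet L 0) * β ^ d := by
    have hfl := fpWeightBar_ge (L := L) hε
    have hpos : 0 < ((2 * π ^ 2)⁻¹) ^ Fintype.card (NzSite L) * ε ^ flatDim L / Real.sqrt (gramDet L 0) := by positivity
    calc (fpWeightBar L ε)⁻¹ ≤ (((2 * π ^ 2)⁻¹) ^ Fintype.card (NzSite L) * ε ^ flatDim L / Real.sqrt (gramDet L 0))⁻¹ := inv_anti₀ hpos hfl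
      _ = (2 * π ^ 2) ^ Fintype.card (NzSite L) * Real.sqrt (gramDet L 0) * β ^ d := by
          rw [hddef, inv_div, div_eq_mul_inv, mul_inv, ← inv_pow, ← inv_pow, inv_inv, hεinv]; ring
  -- (4) powers of `β` are exponentials of `ℓ`
  have hpow : ∀ k : ℕ, β ^ k = Real.exp (k * ℓ) := fun k => by rw [Real.exp_nat_mul, hexpℓ]
  -- assemble
  have hnum : Real.exp (-(β * (8 * (9 * (L : ℝ) * (5 * (x * ℓ ^ 2)) + ε)) ^ 2 / 4)) * Real.exp (49 * β * (min (1 / 40) (x * ℓ) / 12) ^ 2) /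
      stiffGaussTop L (β / 2) β ≤ Real.exp (-ℓ ^ 4) * Real.exp (ℓ ^ 2) * (98 * β) ^ n := by
    rw [div_eq_mul_inv]
    gcongr
  have hden : (((2 * π ^ 2)⁻¹) ^ Fintype.card (Edge 3 L) * fpZ ε * fpWeightBar L ε)⁻¹ ≤
      (2 * π ^ 2) ^ Fintype.card (Edge 3 L) * (80 * β ^ 3) * ((2 * π ^ 2) ^ Fintype.card (NzSite L) * Real.sqrt (gramDet L 0) * β ^ d) := by
    rw [mul_inv, mul_inv, inv_pow, inv_inv]
    gcongr
  have hkey : Real.exp (-ℓ ^ 4) * Real.exp (ℓ ^ 2) * (98 * β) ^ n *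
      ((2 * π ^ 2) ^ Fintype.card (Edge 3 L) * (80 * β ^ 3) * ((2 * π ^ 2) ^ Fintype.card (NzSite L) * Real.sqrt (gramDet L 0) * β ^ d)) ≤
      C * Real.exp (-ℓ) := by
    have hprod : Real.exp (-ℓ ^ 4) * Real.exp (ℓ ^ 2) * Real.exp (n * ℓ) * Real.exp ((3 : ℕ) * ℓ) * Real.exp (d * ℓ) =
        Real.exp (-ℓ ^ 4 + ℓ ^ 2 + n * ℓ + (3 : ℕ) * ℓ + d * ℓ) := by simp only [← Real.exp_add]
    have e : Real.exp (-ℓ ^ 4) * Real.exp (ℓ ^ 2) * (98 * β) ^ n *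
        ((2 * π ^ 2) ^ Fintype.card (Edge 3 L) * (80 * β ^ 3) * ((2 * π ^ 2) ^ Fintype.card (NzSite L) * Real.sqrt (gramDet L 0) * β ^ d)) =
        C * (Real.exp (-ℓ ^ 4) * Real.exp (ℓ ^ 2) * Real.exp (n * ℓ) * Real.exp ((3 : ℕ) * ℓ) * Real.exp (d * ℓ)) := by
      rw [mul_pow, hpow n, hpow 3, hpow d, hCdef]; ring
    rw [e, hprod]
    refine mul_le_mul_of_nonneg_left (Real.exp_le_exp.2 ?_) hC
    push_cast
    have hn0 : (0 : ℝ) ≤ n := Nat.cast_nonneg _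
    have hd0 : (0 : ℝ) ≤ d := Nat.cast_nonneg _
    have hℓ12 : ℓ ≤ ℓ ^ 2 := by
      calc ℓ = ℓ * 1 := (mul_one ℓ).symm
        _ ≤ ℓ * ℓ := mul_le_mul_of_nonneg_left hℓ (by linarith only [hℓ])
        _ = ℓ ^ 2 := (sq ℓ).symm
    have hA : ((n : ℝ) + d + 5) * ℓ ^ 2 ≤ ℓ ^ 4 := by
      calc ((n : ℝ) + d + 5) * ℓ ^ 2 ≤ ℓ ^ 2 * ℓ ^ 2 := mul_le_mul_of_nonneg_right hl2 (sq_nonneg _)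
        _ = ℓ ^ 4 := by ring
    have hB : ((n : ℝ) + d + 4) * ℓ ≤ ((n : ℝ) + d + 4) * ℓ ^ 2 := mul_le_mul_of_nonneg_left hℓ12 (by positivity)
    linarith only [hA, hB]
  have hB0 : 0 ≤ Real.exp (-ℓ ^ 4) * Real.exp (ℓ ^ 2) * (98 * β) ^ n := by positivity
  have hI0 : 0 ≤ (((2 * π ^ 2)⁻¹) ^ Fintype.card (Edge 3 L) * fpZ ε * fpWeightBar L ε)⁻¹ := inv_nonneg.2 (by positivity)
  rw [div_eq_mul_inv]
  exact (mul_le_mul hnum hden hI0 hB0).trans hkey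

end Dominations

/-! ## §3 ★ The four weighted tails -/

section Weighted

variable [NeZero L]

/-- ★ Slice Laplace tail × Gaussian loss, weighted. [folklore] -/
theorem zt_sliceTail_mul_gaussLoss (KD Ksp : ℝ) :
    Tendsto (fun β : ℝ => (1 + KD * ((4 + 48 * Ksp) * (8 * (9 * (L : ℝ) * (5 * (powScale (1 / 2) β * btLog β ^ 2)) + powScale 1 β))) ^ 2) *
        (4 : ℝ) ^ (flatDim L / 2 : ℝ) * Real.exp (-((1 / (4 * sliceConst L)) ^ 2 * (powScale 1 β * btLog β ^ 3) ^ 2 / (4 * (powScale 1 β) ^ 2))) *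
      Real.exp ((96 * (β / 2) + β) * (Real.sqrt ((Fintype.card (Edge 3 L) : ℝ)) * (8 * (9 * (L : ℝ) * (5 * (powScale (1 / 2) β * btLog β ^ 2)) + powScale 1 β))) ^ 2) *
      powScale (-(1 / 5)) β) atTop (𝓝 0) ∧
    Tendsto (fun β : ℝ => (1 + KD * ((4 + 48 * Ksp) * (8 * (9 * (L : ℝ) * (5 * (powScale (1 / 2) β * btLog β ^ 2)) + powScale 1 β))) ^ 2) *
        (4 : ℝ) ^ (flatDim L / 2 : ℝ) * Real.exp (-((1 / (4 * sliceConst L)) ^ 2 * (powScale 1 β * btLog β ^ 3) ^ 2 / (4 * (powScale 1 β) ^ 2))) *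
      Real.exp ((96 * (β / 2) + β) * (Real.sqrt ((Fintype.card (Edge 3 L) : ℝ)) * (8 * (9 * (L : ℝ) * (5 * (powScale (1 / 2) β * btLog β ^ 2)) + powScale 1 β))) ^ 2))
      atTop (𝓝 0) :=
  zt_of_le_exp_neg _ (sliceTail_mul_gaussLoss_le (L := L) KD Ksp)

/-- ★ Slice Laplace tail, weighted. [folklore] -/
theorem zt_sliceTail (KD Ksp : ℝ) :
    Tendsto (fun β : ℝ => (1 + KD * ((4 + 48 * Ksp) * (8 * (9 * (L : ℝ) * (5 * (powScale (1 / 2) β * btLog β ^ 2)) + powScale 1 β))) ^ 2) *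
        (4 : ℝ) ^ (flatDim L / 2 : ℝ) * Real.exp (-((1 / (4 * sliceConst L)) ^ 2 * (powScale 1 β * btLog β ^ 3) ^ 2 / (4 * (powScale 1 β) ^ 2))) *
      powScale (-(1 / 5)) β) atTop (𝓝 0) ∧
    Tendsto (fun β : ℝ => (1 + KD * ((4 + 48 * Ksp) * (8 * (9 * (L : ℝ) * (5 * (powScale (1 / 2) β * btLog β ^ 2)) + powScale 1 β))) ^ 2) *
        (4 : ℝ) ^ (flatDim L / 2 : ℝ) * Real.exp (-((1 / (4 * sliceConst L)) ^ 2 * (powScale 1 β * btLog β ^ 3) ^ 2 / (4 * (powScale 1 β) ^ 2))))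
      atTop (𝓝 0) :=
  zt_of_le_exp_neg _ (sliceTail_le (L := L) KD Ksp)

/-- ★ Relative Gaussian tail of the lower bound, weighted. [folklore] -/
theorem zt_gaussTail :
    Tendsto (fun β : ℝ => Real.exp (49 * β * (min (1 / 40) (powScale (1 / 2) β * btLog β) / 12) ^ 2) *
      (Real.exp (-(β * (min (8 * (9 * (L : ℝ) * (5 * (powScale (1 / 2) β * btLog β ^ 2)) + powScale 1 β) -
          2 * (9 * (L : ℝ) * (5 * (powScale (1 / 2) β * btLog β ^ 2)) + powScale 1 β))
          (9 / 10 * min (1 / 40) (powScale (1 / 2) β * btLog β) -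
            6 * (9 * (L : ℝ) * (5 * (powScale (1 / 2) β * btLog β ^ 2)) + powScale 1 β) ^ 2 * (min (1 / 40) (powScale (1 / 2) β * btLog β) / 12))) ^ 2 / 2)) *
        (π / (β / 2)) ^ ((Module.finrank ℝ (LinkSpace L) : ℝ) / 2)) / stiffGaussTop L (β / 2) β * powScale (-(1 / 5)) β) atTop (𝓝 0) ∧
    Tendsto (fun β : ℝ => Real.exp (49 * β * (min (1 / 40) (powScale (1 / 2) β * btLog β) / 12) ^ 2) *
      (Real.exp (-(β * (min (8 * (9 * (L : ℝ) * (5 * (powScale (1 / 2) β * btLog β ^ 2)) + powScale 1 β) -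
          2 * (9 * (L : ℝ) * (5 * (powScale (1 / 2) β * btLog β ^ 2)) + powScale 1 β))
          (9 / 10 * min (1 / 40) (powScale (1 / 2) β * btLog β) -
            6 * (9 * (L : ℝ) * (5 * (powScale (1 / 2) β * btLog β ^ 2)) + powScale 1 β) ^ 2 * (min (1 / 40) (powScale (1 / 2) β * btLog β) / 12))) ^ 2 / 2)) *
        (π / (β / 2)) ^ ((Module.finrank ℝ (LinkSpace L) : ℝ) / 2)) / stiffGaussTop L (β / 2) β) atTop (𝓝 0) :=
  zt_of_le_exp_neg _ (gaussTail_le (L := L))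

/-- ★ Gauge-far term, weighted. [folklore] -/
theorem zt_farTail :
    Tendsto (fun β : ℝ => Real.exp (-(β * (8 * (9 * (L : ℝ) * (5 * (powScale (1 / 2) β * btLog β ^ 2)) + powScale 1 β)) ^ 2 / 4)) *
        Real.exp (49 * β * (min (1 / 40) (powScale (1 / 2) β * btLog β) / 12) ^ 2) / stiffGaussTop L (β / 2) β /
      (((2 * π ^ 2)⁻¹) ^ Fintype.card (Edge 3 L) * fpZ (powScale 1 β) * fpWeightBar L (powScale 1 β)) * powScale (-(1 / 5)) β) atTop (𝓝 0) ∧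
    Tendsto (fun β : ℝ => Real.exp (-(β * (8 * (9 * (L : ℝ) * (5 * (powScale (1 / 2) β * btLog β ^ 2)) + powScale 1 β)) ^ 2 / 4)) *
        Real.exp (49 * β * (min (1 / 40) (powScale (1 / 2) β * btLog β) / 12) ^ 2) / stiffGaussTop L (β / 2) β /
      (((2 * π ^ 2)⁻¹) ^ Fintype.card (Edge 3 L) * fpZ (powScale 1 β) * fpWeightBar L (powScale 1 β))) atTop (𝓝 0) :=
  zt_of_le_exp_neg _ (farTail_le (L := L))

end Weighted

end Summit.QuantumFields.YangMills.Theorems.FemtoTransferGap.TwoLattice.ConstTube
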